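import Literature.NumberTheory.GaloisRepresentations.PAdicHodge
import Mathlib.RingTheory.TensorProduct.Free
import Mathlib.LinearAlgebra.Matrix.ToLin
import HarnessLib

/-!
# The period vector of a representation with nonzero `D_B`, in coordinates

`Proofs`-style file (theorems only: no definition, no named fact, no instance).

**What is printed.**  Fontaine, Astérisque 223, Exp. III §1.3–1.5: for a `(P, Γ)`-regular ring `B`
and a `P`-representation `V` of `Γ`, `D_B(V) = (B ⊗_P V)^Γ`; in a `P`-basis `(m_k)` of `V` an element
of `B ⊗_P V` is `Σ_k β_k ⊗ m_k` with a unique *period vector* `β ∈ B^κ`, and `Σ β_k ⊗ m_k ∈ D_B(V)`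
iff `β = R(σ) σ(β)` for all `σ`, `R(σ) ∈ GL_κ(P)` the matrix of `ρ(σ)` — equivalently
`σ(β) = R(σ⁻¹) β`: the period vectors are the `Γ`-semi-invariant vectors of `B^κ` for the
contragredient matrices (Fontaine–Ouyang, §2.1.2, proof of Thm. 2.13: "`α_V` in bases").  An
admissible (`dim D_B(V) = dim V`) nonzero `V` therefore has a NONZERO such `β`.

**What is proved here** (for the tree's `PeriodRingData` / `tensorRep` / `D`):
* (private `basis_repr_tensorRep_aux`, a copy of the accepted `basis_repr_tensorRep` of
  `NeronDeRhamDatumOfDeRham` kept here to stay import-light) coordinates of `σ · t`;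
* `mem_D_iff_forall_basis_repr` — `t ∈ D ⟺ ∀ σ, t_• = R(σ) σ(t_•)`;
* `exists_ne_zero_forall_eq_toMatrix_mulVec_smul`, `exists_ne_zero_forall_smul_eq_toMatrix_mulVec` —
  **if `D_B(ρ) ≠ 0` there is `β ≠ 0` in `B^κ` with `β = R(σ) σ(β)`, resp. `σ(β) = R(σ⁻¹) β`,
  for all `σ`** (`R(σ) = LinearMap.toMatrix` of `ρ σ`, pushed to `B`);
* `exists_mem_D_ne_zero_of_isAdmissible` — admissible and `V ≠ 0` ⇒ `D_B(ρ) ≠ 0`.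

## References

* J.-M. Fontaine, *Représentations p-adiques semi-stables*, Astérisque 223 (1994), Exp. III
  §1.3–§1.5. [`FontaineAsterisque223III`]
* J.-M. Fontaine, Y. Ouyang, *Theory of p-adic Galois representations* (2022 draft), §2.1, Thm. 2.13.
  [`FontaineOuyang2022`]
-/

noncomputable section

open scoped TensorProduct
open TensorProduct Matrix

namespace Literature.NumberTheory.GaloisRepresentations

namespace PeriodRingData

universe u v v' w w'

variable {Γ : Type u} [Group Γ] [TopologicalSpace Γ] {P : Type v} {E : Type v'} [Field P]
  [TopologicalSpace P] [Field E] [Algebra P E]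
  {M : Type w'} [AddCommGroup M] [Module P M] [TopologicalSpace M]
  (𝔅 : PeriodRingData.{u, v, v', w} Γ P E) (ρ : ContinuousRep Γ P M)
  {κ : Type*} [Fintype κ] [DecidableEq κ] (bM : Module.Basis κ P M)

omit [TopologicalSpace Γ] [TopologicalSpace P] [TopologicalSpace M] [DecidableEq κ] in
/-- An element of `B ⊗_P V` is `Σ_k t_k ⊗ m_k`, `t_k` its coordinates in the `B`-basis `1 ⊗ m_k`.
[folklore] -/
private theorem eq_sum_repr_tmul (t : 𝔅.B ⊗[P] M) :
    t = ∑ k, (Algebra.TensorProduct.basis 𝔅.B bM).repr t k ⊗ₜ[P] bM k := by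
  conv_lhs => rw [← (Algebra.TensorProduct.basis 𝔅.B bM).sum_repr t]
  exact Finset.sum_congr rfl fun k _ => Algebra.TensorProduct.basis_repr_symm_apply' bM _ k

/-- **Coordinates of `σ · t`.**  For `t = Σ_k t_k ⊗ m_k`:
`(σ t)_j = Σ_k R(σ)_{jk} · σ(t_k)`, `R(σ)_{jk} = (m_j`-coordinate of `ρ(σ) m_k)` — a private copy of
the accepted `PeriodRingData.basis_repr_tensorRep` (file `PAdicHodge/NeronDeRhamDatumOfDeRham`, whose
elliptic-curve imports this coordinate file avoids). [cite: FontaineAsterisque223III, Exp. III §1.3] -/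
private theorem basis_repr_tensorRep_aux (σ : Γ) (t : 𝔅.B ⊗[P] M) (j : κ) :
    (Algebra.TensorProduct.basis 𝔅.B bM).repr (𝔅.tensorRep ρ σ t) j =
      ∑ k, algebraMap P 𝔅.B (LinearMap.toMatrix bM bM (ρ σ) j k) *
        σ • (Algebra.TensorProduct.basis 𝔅.B bM).repr t k := by
  conv_lhs => rw [eq_sum_repr_tmul 𝔅 bM t, map_sum]
  simp only [tensorRep_apply_tmul, map_sum, Finset.sum_apply', Algebra.TensorProduct.basis_repr_tmul,
    Finsupp.smul_apply, Finsupp.mapRange_apply, LinearMap.toMatrix_apply, smul_eq_mul]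
  exact Finset.sum_congr rfl fun k _ => mul_comm _ _

/-- **Invariance in coordinates**: `t ∈ D_B(ρ)` iff `t_j = Σ_k R(σ)_{jk} σ(t_k)` for all `σ, j`.
[cite: FontaineAsterisque223III, Exp. III §1.3] [cite: FontaineOuyang2022, Thm. 2.13] -/
theorem mem_D_iff_forall_basis_repr (t : 𝔅.B ⊗[P] M) :
    t ∈ 𝔅.D ρ ↔ ∀ σ j, (Algebra.TensorProduct.basis 𝔅.B bM).repr t j =
      ∑ k, algebraMap P 𝔅.B (LinearMap.toMatrix bM bM (ρ σ) j k) *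
        σ • (Algebra.TensorProduct.basis 𝔅.B bM).repr t k := by
  rw [mem_D_iff]
  refine ⟨fun h σ j => ?_, fun h σ => ?_⟩
  · rw [← basis_repr_tensorRep_aux 𝔅 ρ bM σ t j, h σ]
  · apply (Algebra.TensorProduct.basis 𝔅.B bM).repr.injective
    ext j
    rw [basis_repr_tensorRep_aux, ← h σ j]

/-- **A nonzero period vector.**  If `D_B(ρ) ≠ 0` there is `β ≠ 0` in `B^κ` with
`β_j = Σ_k R(σ)_{jk} σ(β_k)` for all `σ ∈ Γ` (the coordinates of a nonzero element of `D_B(ρ)`).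
[cite: FontaineAsterisque223III, Exp. III §1.5] [cite: FontaineOuyang2022, Thm. 2.13] -/
theorem exists_ne_zero_forall_eq_toMatrix_mulVec_smul (hD : ∃ t ∈ 𝔅.D ρ, t ≠ 0) :
    ∃ β : κ → 𝔅.B, β ≠ 0 ∧ ∀ σ : Γ,
      β = (LinearMap.toMatrix bM bM (ρ σ)).map (algebraMap P 𝔅.B) *ᵥ (fun k => σ • β k) := by
  obtain ⟨t, ht, ht0⟩ := hD
  refine ⟨⇑((Algebra.TensorProduct.basis 𝔅.B bM).repr t), fun h => ht0 ?_, fun σ => ?_⟩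
  · exact (Algebra.TensorProduct.basis 𝔅.B bM).repr.map_eq_zero_iff.1 (Finsupp.coe_eq_zero.1 h)
  · funext j
    rw [(mem_D_iff_forall_basis_repr 𝔅 ρ bM t).1 ht σ j]
    simp only [Matrix.mulVec, dotProduct, Matrix.map_apply]

/-- `R(σ⁻¹) R(σ) = 1` after `algebraMap P B`. [folklore] -/
private theorem toMatrix_map_inv_mul (σ : Γ) :
    (LinearMap.toMatrix bM bM (ρ σ⁻¹)).map (algebraMap P 𝔅.B) *
        (LinearMap.toMatrix bM bM (ρ σ)).map (algebraMap P 𝔅.B) = 1 := by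
  rw [← Matrix.map_mul, ← LinearMap.toMatrix_mul, ← map_mul, inv_mul_cancel, map_one,
    LinearMap.toMatrix_one, Matrix.map_one _ (map_zero _) (map_one _)]

/-- **Semi-invariant form**: if `D_B(ρ) ≠ 0` there is `β ≠ 0` in `B^κ` with
`σ(β) = R(σ⁻¹) · β` for all `σ ∈ Γ` — the period vector is semi-invariant for the contragredient
matrices. [cite: FontaineAsterisque223III, Exp. III §1.5] [cite: FontaineOuyang2022, Thm. 2.13] -/
theorem exists_ne_zero_forall_smul_eq_toMatrix_mulVec (hD : ∃ t ∈ 𝔅.D ρ, t ≠ 0) :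
    ∃ β : κ → 𝔅.B, β ≠ 0 ∧ ∀ σ : Γ,
      (fun k => σ • β k) = (LinearMap.toMatrix bM bM (ρ σ⁻¹)).map (algebraMap P 𝔅.B) *ᵥ β := by
  obtain ⟨β, hβ0, hβ⟩ := exists_ne_zero_forall_eq_toMatrix_mulVec_smul 𝔅 ρ bM hD
  refine ⟨β, hβ0, fun σ => ?_⟩
  conv_rhs => rw [hβ σ]
  rw [Matrix.mulVec_mulVec, toMatrix_map_inv_mul, Matrix.one_mulVec]

/-- **Admissible and nonzero ⇒ `D_B(ρ) ≠ 0`** (`dim_E D_B(ρ) = dim_P V > 0`).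
[cite: FontaineAsterisque223III, Exp. III §1.5] -/
theorem exists_mem_D_ne_zero_of_isAdmissible [FiniteDimensional P M] [Nontrivial M]
    (h : 𝔅.IsAdmissible ρ) : ∃ t ∈ 𝔅.D ρ, t ≠ 0 := by
  apply Submodule.exists_mem_ne_zero_of_ne_bot
  intro hbot
  have h0 : Module.finrank E (𝔅.D ρ) = 0 := by rw [hbot, finrank_bot]
  rw [IsAdmissible] at h
  exact (Module.finrank_pos (R := P) (M := M)).ne' (h ▸ h0)

end PeriodRingData

end Literature.NumberTheory.GaloisRepresentations

end
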